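import Literature.NumberTheory.LFunctions.RudnickSarnakHyperplane
import Literature.NumberTheory.LFunctions.RudnickSarnakStrata
import Mathlib.MeasureTheory.Integral.Prod
import HarnessLib

/-!
# Rudnick–Sarnak (4.14): the pull-back `ι_F^* f_Φ` is `f_{Φ_F}` with `Φ_F` the fibre integral

Z. Rudnick, P. Sarnak, Duke Math. J. **81** (1996), p. 306: for a set partition `F` of
`N = {1, …, n}` into `ν` blocks with block map `ι_F : ℝ^ν → ℝⁿ`, the pulled-back test function
`ι_F^* f_Φ = f_Φ ∘ ι_F` is again of the form (3.6), `ι_F^* f_Φ = f_{Φ_F}` ((4.14)), where `Φ_F` is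
obtained from `Φ` by integrating over the fibres `{ξ : ∑_{i ∈ F_j} ξ_i = ζ_j}` of the block-sum
map. Here, for a set partition `Q` of `Fin (k+1)` and a labelling `ι : Fin (k+1) → Fin (m+1)` of
its blocks:

* `fillQ Q ι ζ w` — the point of the fibre over `ζ` with free coordinates `w` (in the coordinates
  of `RudnickSarnakStrata.lean`: `extG Q w` plus `ζ_{ι a}` at the representative of each block);
* `fibreIntegral Q ι Φ ζ = ∫ Φ(fillQ Q ι ζ w) dw` — the fibre integral `Φ_Q(ζ)`;
* **`rsPhiTest_fibreIntegral`** — (4.14): `f_{Φ_Q}(z) = f_Φ(z ∘ ι)` for continuous compactly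
  supported `Φ`. Proof: both sides are hyperplane integrals (`rsPhiTest_eq_hypInt`); the map
  "slice coordinates `η` of `ξ` ↦ (slice coordinates of the block sums, free coordinates)" is a
  split of coordinates, a reindexing and a shear, hence measure preserving
  (`integral_hypPoint_eq_integral_integral_fillQ`); when the block of `0` does not carry the
  label `0` one first relabels by a transposition (`rsPhiTest_comp_perm`).

## References

* Z. Rudnick, P. Sarnak, Duke Math. J. 81 (1996), (4.11)–(4.14).
-/

noncomputable section

open MeasureTheory Finset Equiv Complex
open scoped Real

namespace Literature.NumberTheory.LFunctions

namespace RudnickSarnak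

variable {k m : ℕ} (Q : Finpartition (univ : Finset (Fin (k + 1)))) (ι : Fin (k + 1) → Fin (m + 1))

/-! ## The fibres of the block-sum map -/

/-- The point of the fibre `{ξ : ∑_{i ∈ block b} ξ_i = ζ_b for all b}` with free coordinates `w`:
`extG Q w` corrected by `ζ_{ι a}` at the representative of each block.
[cite: RudnickSarnak1996, (4.14)] -/
def fillQ (ζ : Fin (m + 1) → ℝ) (w : Free Q → ℝ) (j : Fin (k + 1)) : ℝ :=
  extG Q w j + if IsRep Q j then ζ (ι j) else 0

/-- The fibre integral `Φ_Q(ζ) = ∫ Φ(ξ) dξ` over the fibre of the block-sum map above `ζ`, in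
the free coordinates. [cite: RudnickSarnak1996, (4.14)] -/
def fibreIntegral (Φ : (Fin (k + 1) → ℝ) → ℂ) (ζ : Fin (m + 1) → ℝ) : ℂ :=
  ∫ w : Free Q → ℝ, Φ (fillQ Q ι ζ w)

/-- On free indices `fillQ` is the free coordinate. [folklore] -/
theorem fillQ_apply_of_not_isRep (ζ : Fin (m + 1) → ℝ) (w : Free Q → ℝ) {j : Fin (k + 1)}
    (h : ¬IsRep Q j) : fillQ Q ι ζ w j = w ⟨j, h⟩ := by
  simp [fillQ, h, extG_apply_of_not_isRep Q w h]

/-- At a representative `fillQ` is `ζ_{ι j}` minus the free coordinates of the block. [folklore] -/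
theorem fillQ_apply_of_isRep (ζ : Fin (m + 1) → ℝ) (w : Free Q → ℝ) {j : Fin (k + 1)}
    (h : IsRep Q j) : fillQ Q ι ζ w j = ζ (ι j) - ∑ i ∈ (Q.part j).erase j, liftFree Q w i := by
  simp only [fillQ, h, ↓reduceIte, extG_apply_of_isRep Q w h]
  ring

section labels

variable (hι : ∀ a b : Fin (k + 1), ι a = ι b ↔ Q.part a = Q.part b)
include hι

/-- Membership in a block in terms of the labels. [folklore] -/
theorem mem_part_iff_label_eq {a j : Fin (k + 1)} : j ∈ Q.part a ↔ ι j = ι a := by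
  rw [hι]
  constructor
  · intro h
    exact (Q.part_eq_of_mem (Q.part_mem.2 (mem_univ a)) h).symm ▸ rfl
  · intro h
    rw [← h]
    exact Q.mem_part_self.2 (mem_univ j)

/-- **The block sums of a fibre point are `ζ`.** [cite: RudnickSarnak1996, (4.14)] -/
theorem sum_part_fillQ (ζ : Fin (m + 1) → ℝ) (w : Free Q → ℝ) (a : Fin (k + 1)) :
    ∑ j ∈ Q.part a, fillQ Q ι ζ w j = ζ (ι a) := by
  simp only [fillQ, Finset.sum_add_distrib, sum_part_extG, zero_add]
  rw [← Finset.add_sum_erase _ _ (rep_mem Q a), if_pos (isRep_rep Q a)]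
  have h0 : ∑ j ∈ (Q.part a).erase (rep Q a), (if IsRep Q j then ζ (ι j) else 0) = 0 := by
    refine Finset.sum_eq_zero fun j hj ↦ ?_
    obtain ⟨hne, hj⟩ := Finset.mem_erase.1 hj
    rw [if_neg (fun h ↦ hne (eq_rep_of_isRep_of_mem Q h hj))]
  rw [h0, add_zero]
  congr 1
  exact (mem_part_iff_label_eq Q ι hι).1 (rep_mem Q a)

/-- `∑_j z_{ι j} ξ_j = ∑_b z_b ζ_b` on the fibre above `ζ` (for labels hit by `ι`; unused labels
do not occur when `ι` is surjective). [cite: RudnickSarnak1996, (4.11)] -/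
theorem sum_label_mul_fillQ (hιs : Function.Surjective ι) (z : Fin (m + 1) → ℝ)
    (ζ : Fin (m + 1) → ℝ) (w : Free Q → ℝ) :
    ∑ j, z (ι j) * fillQ Q ι ζ w j = ∑ b, z b * ζ b := by
  rw [← Finset.sum_fiberwise univ ι (fun j ↦ z (ι j) * fillQ Q ι ζ w j)]
  refine Finset.sum_congr rfl fun b _ ↦ ?_
  obtain ⟨a, rfl⟩ := hιs b
  have hfib : univ.filter (fun j ↦ ι j = ι a) = Q.part a := by
    ext j
    simp [mem_part_iff_label_eq Q ι hι]
  rw [hfib, ← sum_part_fillQ Q ι hι ζ w a, Finset.mul_sum]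
  refine Finset.sum_congr rfl fun j hj ↦ ?_
  rw [(mem_part_iff_label_eq Q ι hι).1 hj]

end labels

/-! ## Continuity and support of the fibre integral -/

/-- `fillQ` is continuous in `(ζ, w)`. [folklore] -/
theorem continuous_fillQ : Continuous fun p : (Fin (m + 1) → ℝ) × (Free Q → ℝ) ↦ fillQ Q ι p.1 p.2 := by
  refine continuous_pi fun j ↦ ?_
  simp only [fillQ]
  refine ((continuous_apply j).comp ((continuous_extG Q).comp continuous_snd)).add ?_
  by_cases h : IsRep Q j
  · simp only [h, ↓reduceIte]
    exact (continuous_apply (ι j)).comp continuous_fst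
  · simp only [h, ↓reduceIte]
    exact continuous_const

/-- `0` is the representative of its block. [folklore] -/
theorem isRep_zero : IsRep Q (0 : Fin (k + 1)) :=
  le_antisymm (rep_le Q (Q.mem_part_self.2 (mem_univ 0))) (Fin.zero_le _)

/-- Free coordinates are bounded by the norm of the fibre point. [folklore] -/
theorem norm_free_le_norm_fillQ (ζ : Fin (m + 1) → ℝ) (w : Free Q → ℝ) :
    ‖w‖ ≤ ‖fillQ Q ι ζ w‖ := by
  rw [pi_norm_le_iff_of_nonneg (norm_nonneg _)]
  intro j
  have := norm_le_pi_norm (fillQ Q ι ζ w) j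
  rwa [fillQ_apply_of_not_isRep Q ι ζ w j.2] at this

section support

variable (hι : ∀ a b : Fin (k + 1), ι a = ι b ↔ Q.part a = Q.part b) (hιs : Function.Surjective ι)
include hι hιs

/-- The block sums are bounded by `(k+1)` times the norm of the fibre point. [folklore] -/
theorem norm_label_le_norm_fillQ (ζ : Fin (m + 1) → ℝ) (w : Free Q → ℝ) :
    ‖ζ‖ ≤ (k + 1) * ‖fillQ Q ι ζ w‖ := by
  rw [pi_norm_le_iff_of_nonneg (by positivity)]
  intro b
  obtain ⟨a, rfl⟩ := hιs b
  rw [← sum_part_fillQ Q ι hι ζ w a]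
  calc ‖∑ j ∈ Q.part a, fillQ Q ι ζ w j‖ ≤ ∑ j ∈ Q.part a, ‖fillQ Q ι ζ w j‖ := norm_sum_le _ _
    _ ≤ ∑ j ∈ Q.part a, ‖fillQ Q ι ζ w‖ := Finset.sum_le_sum fun j _ ↦ norm_le_pi_norm _ j
    _ ≤ ∑ _j : Fin (k + 1), ‖fillQ Q ι ζ w‖ :=
        Finset.sum_le_sum_of_subset_of_nonneg (Finset.subset_univ _) fun _ _ _ ↦ norm_nonneg _
    _ = (k + 1) * ‖fillQ Q ι ζ w‖ := by simp

omit hι hιs in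
/-- **The fibre integral is continuous** (for continuous compactly supported `Φ`; dominated
convergence with the bound `‖Φ‖_∞ 𝟙_{‖w‖ ≤ R}`). [folklore] -/
theorem continuous_fibreIntegral {Φ : (Fin (k + 1) → ℝ) → ℂ} (hΦc : Continuous Φ)
    (hΦs : HasCompactSupport Φ) : Continuous (fibreIntegral Q ι Φ) := by
  obtain ⟨R, hR⟩ := hΦs.isCompact.isBounded.subset_closedBall 0
  obtain ⟨C, hC⟩ := hΦc.bounded_above_of_compact_support hΦs
  unfold fibreIntegral
  refine continuous_of_dominated (bound := fun w ↦ (Metric.closedBall (0 : Free Q → ℝ) R).indicator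
    (fun _ ↦ C) w) ?_ ?_ ?_ ?_
  · intro ζ
    exact (hΦc.comp ((continuous_fillQ Q ι).comp (Continuous.prodMk_right ζ))).aestronglyMeasurable
  · intro ζ
    refine Filter.Eventually.of_forall fun w ↦ ?_
    by_cases hw : w ∈ Metric.closedBall (0 : Free Q → ℝ) R
    · rw [Set.indicator_of_mem hw]
      exact hC _
    · rw [Set.indicator_of_notMem hw]
      have : Φ (fillQ Q ι ζ w) = 0 := by
        by_contra h
        have hmem := hR (subset_tsupport _ (Function.mem_support.2 h))
        rw [Metric.mem_closedBall, dist_zero_right] at hmem hw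
        exact hw ((norm_free_le_norm_fillQ Q ι ζ w).trans hmem)
      rw [this, norm_zero]
  · exact (integrable_indicator_iff measurableSet_closedBall).2
      (ContinuousOn.integrableOn_compact (isCompact_closedBall _ _) continuousOn_const)
  · refine Filter.Eventually.of_forall fun w ↦ ?_
    exact hΦc.comp ((continuous_fillQ Q ι).comp (Continuous.prodMk_left w))

/-- **The fibre integral has compact support**: `Φ_Q(ζ) ≠ 0` forces
`‖ζ‖ ≤ (k+1) R` if `Φ` is supported in the ball of radius `R`. [folklore] -/
theorem hasCompactSupport_fibreIntegral {Φ : (Fin (k + 1) → ℝ) → ℂ} (hΦs : HasCompactSupport Φ) :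
    HasCompactSupport (fibreIntegral Q ι Φ) := by
  obtain ⟨R, hR⟩ := hΦs.isCompact.isBounded.subset_closedBall 0
  refine HasCompactSupport.of_support_subset_isCompact (isCompact_closedBall (0 : Fin (m + 1) → ℝ)
    ((k + 1) * R)) fun ζ hζ ↦ ?_
  rw [Metric.mem_closedBall, dist_zero_right]
  by_contra hlt
  apply hζ
  unfold fibreIntegral
  refine integral_eq_zero_of_ae (Filter.Eventually.of_forall fun w ↦ ?_)
  by_contra h
  have hmem := hR (subset_tsupport _ (Function.mem_support.2 h))
  rw [Metric.mem_closedBall, dist_zero_right] at hmem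
  exact hlt ((norm_label_le_norm_fillQ Q ι hι hιs ζ w).trans (by nlinarith [norm_nonneg ζ]))

end support

/-! ## The change of variables behind (4.14) -/

section change

variable (hι : ∀ a b : Fin (k + 1), ι a = ι b ↔ Q.part a = Q.part b) (hιs : Function.Surjective ι)
  (hι0 : ι 0 = 0)
include hι hιs hι0

omit hιs in
/-- A nonzero representative has a nonzero label (when the block of `0` is labelled `0`).
[folklore] -/
theorem label_ne_zero_of_isRep {r : Fin (k + 1)} (hr : IsRep Q r) (hr0 : r ≠ 0) : ι r ≠ 0 := by
  intro h
  rw [← hι0, hι] at h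
  apply hr0
  have h1 : r = rep Q 0 := eq_rep_of_isRep_of_mem Q hr (h ▸ Q.mem_part_self.2 (mem_univ r))
  rw [h1]
  exact isRep_zero Q

omit hιs hι0 in
/-- Representatives with the same label coincide. [folklore] -/
theorem eq_of_isRep_of_label_eq {r r' : Fin (k + 1)} (hr : IsRep Q r) (hr' : IsRep Q r')
    (h : ι r = ι r') : r = r' := by
  rw [hι] at h
  have : r ∈ Q.part r' := h ▸ Q.mem_part_self.2 (mem_univ r)
  rw [eq_rep_of_isRep_of_mem Q hr this]
  exact hr'

/-- The slice indices carrying nonzero representatives. [folklore] -/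
abbrev RepSlot : Type := {i : Fin k // IsRep Q i.succ}

/-- The slice indices carrying free coordinates. [folklore] -/
abbrev FreeSlot : Type := {i : Fin k // ¬IsRep Q i.succ}

/-- The labels of the nonzero representatives, shifted down by one: a bijection
`RepSlot Q ≃ Fin m`. [folklore] -/
def repSlotEquiv : RepSlot Q ≃ Fin m :=
  Equiv.ofBijective
    (fun i ↦ (ι i.1.succ).pred (label_ne_zero_of_isRep Q ι hι hι0 i.2 (Fin.succ_ne_zero _)))
    (by
      constructor
      · intro i j h
        have h' : ι i.1.succ = ι j.1.succ := by
          rw [← Fin.succ_pred (ι i.1.succ) (label_ne_zero_of_isRep Q ι hι hι0 i.2 (Fin.succ_ne_zero _)),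
            ← Fin.succ_pred (ι j.1.succ) (label_ne_zero_of_isRep Q ι hι hι0 j.2 (Fin.succ_ne_zero _))]
          exact congrArg Fin.succ h
        exact Subtype.ext (Fin.succ_injective _ (eq_of_isRep_of_label_eq Q ι hι i.2 j.2 h'))
      · intro b
        obtain ⟨a, ha⟩ := hιs b.succ
        set r := rep Q a with hr
        have hιr : ι r = b.succ := by
          rw [← ha]
          exact (mem_part_iff_label_eq Q ι hι).1 (rep_mem Q a)
        have hr0 : r ≠ 0 := by
          intro h
          rw [h, hι0] at hιr
          exact Fin.succ_ne_zero _ hιr.symm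
        refine ⟨⟨r.pred hr0, by rw [Fin.succ_pred]; exact isRep_rep Q a⟩, ?_⟩
        apply Fin.succ_injective
        simp only [Fin.succ_pred]
        exact hιr)

/-- [folklore] -/
theorem succ_label_repSlotEquiv (i : RepSlot Q) :
    (repSlotEquiv Q ι hι hιs hι0 i).succ = ι i.1.succ := by
  simp [repSlotEquiv]

omit hι hιs hι0 in
/-- Free indices are successors (`0` is a representative): `FreeSlot Q ≃ Free Q`. [folklore] -/
def freeSlotEquiv : FreeSlot Q ≃ Free Q where
  toFun i := ⟨i.1.succ, i.2⟩
  invFun j := ⟨j.1.pred (fun h ↦ j.2 (h ▸ isRep_zero Q)), by rw [Fin.succ_pred]; exact j.2⟩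
  left_inv i := by simp
  right_inv j := by simp

/-- The translation part of the change of variables: for the label `b`, the sum of the free
coordinates of the block whose representative carries it. [folklore] -/
def fibreShift (w : Free Q → ℝ) (b : Fin m) : ℝ :=
  ∑ i ∈ (Q.part ((repSlotEquiv Q ι hι hιs hι0).symm b).1.succ).erase
    ((repSlotEquiv Q ι hι hιs hι0).symm b).1.succ, liftFree Q w i

omit hι hιs hι0 in
/-- The shear `(θ, w) ↦ (θ + D w, w)` as a measurable equivalence. [folklore] -/
def shearMEquiv {α β : Type*} [MeasurableSpace α] [MeasurableSpace β] [AddCommGroup α]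
    [MeasurableAdd₂ α] [MeasurableNeg α] (D : β → α) (hD : Measurable D) : α × β ≃ᵐ α × β where
  toFun p := (p.1 + D p.2, p.2)
  invFun p := (p.1 - D p.2, p.2)
  left_inv p := by simp
  right_inv p := by simp
  measurable_toFun := (measurable_fst.add (hD.comp measurable_snd)).prodMk measurable_snd
  measurable_invFun := (measurable_fst.sub (hD.comp measurable_snd)).prodMk measurable_snd

omit hι hιs hι0 in
/-- A shear preserves a product of an invariant measure with any measure. [folklore] -/
theorem measurePreserving_shear {α β : Type*} [MeasurableSpace α] [MeasurableSpace β]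
    [AddCommGroup α] [MeasurableAdd₂ α] [MeasurableNeg α] (μ : Measure α) (ν : Measure β)
    [SFinite μ] [SFinite ν] [μ.IsAddRightInvariant] (D : β → α) (hD : Measurable D) :
    MeasurePreserving (shearMEquiv D hD) (μ.prod ν) (μ.prod ν) := by
  have h1 : MeasurePreserving (fun p : β × α ↦ (id p.1, (fun (b : β) (a : α) ↦ a + D b) p.1 p.2))
      (ν.prod μ) (ν.prod μ) :=
    MeasurePreserving.skew_product (MeasurePreserving.id _)
      (measurable_snd.add (hD.comp measurable_fst))
      (Filter.Eventually.of_forall fun b ↦ (measurePreserving_add_right μ (D b)).map_eq)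
  have : (shearMEquiv D hD : α × β → α × β) =
      Prod.swap ∘ (fun p : β × α ↦ (id p.1, (fun (b : β) (a : α) ↦ a + D b) p.1 p.2)) ∘ Prod.swap := by
    funext p
    rfl
  rw [this]
  exact Measure.measurePreserving_swap.comp (h1.comp Measure.measurePreserving_swap)

/-- Measurability of the translation part. [folklore] -/
theorem measurable_fibreShift : Measurable (fibreShift Q ι hι hιs hι0) := by
  refine measurable_pi_iff.2 fun b ↦ ?_
  refine Finset.measurable_sum _ fun i _ ↦ ?_
  by_cases h : IsRep Q i
  · simp only [liftFree, h, ↓reduceDIte]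
    exact measurable_const
  · simp only [liftFree, h, ↓reduceDIte]
    exact measurable_pi_apply _

/-- **The change of variables** `η ↦ (θ, w)` from the slice coordinates of `ξ = (-∑η, η)` to the
slice coordinates `θ` of its block sums and its free coordinates `w`: split, reindex, shear.
[cite: RudnickSarnak1996, (4.14)] -/
def fibreChange : (Fin k → ℝ) ≃ᵐ (Fin m → ℝ) × (Free Q → ℝ) :=
  (MeasurableEquiv.piEquivPiSubtypeProd (fun _ : Fin k ↦ ℝ) (fun i ↦ IsRep Q i.succ)).trans
    ((MeasurableEquiv.prodCongr
      (MeasurableEquiv.piCongrLeft (fun _ : Fin m ↦ ℝ) (repSlotEquiv Q ι hι hιs hι0))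
      (MeasurableEquiv.piCongrLeft (fun _ : Free Q ↦ ℝ) (freeSlotEquiv Q))).trans
    (shearMEquiv (fibreShift Q ι hι hιs hι0) (measurable_fibreShift Q ι hι hιs hι0)))

/-- **The change of variables preserves Lebesgue measure.** [cite: RudnickSarnak1996, (4.14)] -/
theorem measurePreserving_fibreChange :
    MeasurePreserving (fibreChange Q ι hι hιs hι0) (volume : Measure (Fin k → ℝ))
      ((volume : Measure (Fin m → ℝ)).prod (volume : Measure (Free Q → ℝ))) := by
  unfold fibreChange
  rw [MeasurableEquiv.coe_trans, MeasurableEquiv.coe_trans]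
  refine (measurePreserving_shear (volume : Measure (Fin m → ℝ)) (volume : Measure (Free Q → ℝ))
    _ (measurable_fibreShift Q ι hι hιs hι0)).comp ?_
  refine MeasurePreserving.comp ?_
    (volume_preserving_piEquivPiSubtypeProd (fun _ : Fin k ↦ ℝ) (fun i ↦ IsRep Q i.succ))
  exact (volume_measurePreserving_piCongrLeft (fun _ : Fin m ↦ ℝ) _).prod
    (volume_measurePreserving_piCongrLeft (fun _ : Free Q ↦ ℝ) _)

/-- The free component of the change of variables: `w_j = η_{j-1}`. [folklore] -/
theorem fibreChange_snd (η : Fin k → ℝ) (j : Free Q) :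
    (fibreChange Q ι hι hιs hι0 η).2 j = η ((freeSlotEquiv Q).symm j).1 := by
  simp only [fibreChange, MeasurableEquiv.trans_apply, MeasurableEquiv.prodCongr,
    MeasurableEquiv.coe_mk, Equiv.prodCongr_apply, shearMEquiv]
  have := MeasurableEquiv.piCongrLeft_apply_apply (freeSlotEquiv Q) (β := fun _ : Free Q ↦ ℝ)
    (fun i : FreeSlot Q ↦ η i.1) ((freeSlotEquiv Q).symm j)
  rw [Equiv.apply_symm_apply] at this
  convert this using 2
  simp [MeasurableEquiv.piEquivPiSubtypeProd_apply]

/-- The label component of the change of variables: `θ_b = η_{r_b - 1} + (free sum of the block)`.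
[folklore] -/
theorem fibreChange_fst (η : Fin k → ℝ) (b : Fin m) :
    (fibreChange Q ι hι hιs hι0 η).1 b =
      η ((repSlotEquiv Q ι hι hιs hι0).symm b).1 + fibreShift Q ι hι hιs hι0 (fibreChange Q ι hι hιs hι0 η).2 b := by
  simp only [fibreChange, MeasurableEquiv.trans_apply, MeasurableEquiv.prodCongr,
    MeasurableEquiv.coe_mk, Equiv.prodCongr_apply, Prod.map_snd, Prod.map_fst, shearMEquiv,
    Equiv.coe_fn_mk, Pi.add_apply]
  congr 1
  have := MeasurableEquiv.piCongrLeft_apply_apply (repSlotEquiv Q ι hι hιs hι0)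
    (β := fun _ : Fin m ↦ ℝ) (fun i : RepSlot Q ↦ η i.1) ((repSlotEquiv Q ι hι hιs hι0).symm b)
  rw [Equiv.apply_symm_apply] at this
  convert this using 2
  simp [MeasurableEquiv.piEquivPiSubtypeProd_apply]

/-- **The fibre point over the block sums of `ξ = (-∑η, η)` with the free coordinates of `ξ` is
`ξ`.** [cite: RudnickSarnak1996, (4.14)] -/
theorem fillQ_fibreChange (η : Fin k → ℝ) :
    fillQ Q ι (hypPoint (fibreChange Q ι hι hιs hι0 η).1) (fibreChange Q ι hι hιs hι0 η).2 = hypPoint η := by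
  set θ := (fibreChange Q ι hι hιs hι0 η).1 with hθ
  set w := (fibreChange Q ι hι hιs hι0 η).2 with hw
  -- all nonzero coordinates agree
  have hsucc : ∀ i : Fin k, fillQ Q ι (hypPoint θ) w i.succ = η i := by
    intro i
    by_cases h : IsRep Q i.succ
    · rw [fillQ_apply_of_isRep Q ι _ _ h]
      have hne := label_ne_zero_of_isRep Q ι hι hι0 h (Fin.succ_ne_zero _)
      -- `ι i.succ = b.succ` with `b = repSlotEquiv ⟨i, h⟩`
      have hb := succ_label_repSlotEquiv Q ι hι hιs hι0 ⟨i, h⟩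
      rw [← hb]
      simp only [hypPoint, Fin.cons_succ]
      rw [hθ, fibreChange_fst, Equiv.symm_apply_apply]
      simp only [fibreShift, Equiv.symm_apply_apply]
      ring
    · rw [fillQ_apply_of_not_isRep Q ι _ _ h, hw, fibreChange_snd]
      rfl
  funext j
  refine Fin.cases ?_ (fun i ↦ ?_) j
  · -- the `0`-coordinate, from the vanishing of the total sums
    have h1 : ∑ j, fillQ Q ι (hypPoint θ) w j = 0 := by
      rw [← Finset.sum_fiberwise univ ι (fun j ↦ fillQ Q ι (hypPoint θ) w j)]
      have : ∀ b : Fin (m + 1), ∑ j ∈ univ.filter (fun j ↦ ι j = b), fillQ Q ι (hypPoint θ) w j =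
          hypPoint θ b := by
        intro b
        obtain ⟨a, rfl⟩ := hιs b
        have hfib : univ.filter (fun j ↦ ι j = ι a) = Q.part a := by
          ext j'
          simp [mem_part_iff_label_eq Q ι hι]
        rw [hfib, sum_part_fillQ Q ι hι]
      rw [Finset.sum_congr rfl (fun b _ ↦ this b)]
      exact sum_hypPoint θ
    have h2 := sum_hypPoint η
    rw [Fin.sum_univ_succ] at h1 h2
    simp only [hsucc] at h1
    simp only [hypPoint, Fin.cons_succ] at h2
    linarith
  · rw [hsucc]
    rfl

/-- **The hyperplane integral as an iterated integral over block sums and fibres**: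
`∫ F(ξ) δ(∑ξ) dξ = ∫ (∫ F(fillQ ζ w) dw) δ(∑ζ) dζ` for continuous compactly supported `F`
(labelling with `ι 0 = 0`). [cite: RudnickSarnak1996, (4.14)] -/
theorem integral_hypPoint_eq_integral_integral_fillQ {F : (Fin (k + 1) → ℝ) → ℂ}
    (hFc : Continuous F) (hFs : HasCompactSupport F) :
    (∫ η : Fin k → ℝ, F (hypPoint η)) =
      ∫ θ : Fin m → ℝ, ∫ w : Free Q → ℝ, F (fillQ Q ι (hypPoint θ) w) := by
  set e := fibreChange Q ι hι hιs hι0 with he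
  have hev := measurePreserving_fibreChange Q ι hι hιs hι0
  set G : (Fin m → ℝ) × (Free Q → ℝ) → ℂ := fun p ↦ F (fillQ Q ι (hypPoint p.1) p.2) with hG
  -- `F ∘ hypPoint = G ∘ e`
  have hcomp : (fun η : Fin k → ℝ ↦ F (hypPoint η)) = G ∘ e := by
    funext η
    simp only [Function.comp_apply, hG]
    rw [fillQ_fibreChange]
  -- integrability of `F ∘ hypPoint`
  have hint : Integrable (fun η : Fin k → ℝ ↦ F (hypPoint η)) := by
    have hc : Continuous fun η : Fin k → ℝ ↦ hypPoint η := by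
      refine continuous_pi fun j ↦ ?_
      refine Fin.cases ?_ (fun i ↦ ?_) j
      · simp only [hypPoint, Fin.cons_zero]
        exact (continuous_finsetSum _ fun i _ ↦ continuous_apply i).neg
      · simp only [hypPoint, Fin.cons_succ]
        exact continuous_apply i
    refine (hFc.comp hc).integrable_of_hasCompactSupport ?_
    obtain ⟨R, hR⟩ := hFs.isCompact.isBounded.subset_closedBall 0
    refine HasCompactSupport.of_support_subset_isCompact (isCompact_closedBall (0 : Fin k → ℝ) R)
      fun η hη ↦ ?_
    have hmem := hR (subset_tsupport _ (Function.mem_support.2 hη))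
    rw [Metric.mem_closedBall, dist_zero_right] at hmem ⊢
    refine le_trans ?_ hmem
    rw [pi_norm_le_iff_of_nonneg (norm_nonneg _)]
    intro i
    have := norm_le_pi_norm (hypPoint η) i.succ
    simpa [hypPoint] using this
  have hGint : Integrable G ((volume : Measure (Fin m → ℝ)).prod volume) := by
    rw [← hev.integrable_comp_emb e.measurableEmbedding, ← hcomp]
    exact hint
  rw [hcomp]
  exact (hev.integral_comp' (f := e) G).trans (integral_prod G hGint)

end change

/-! ## (4.14) -/

/-- Relabelling by a permutation `γ` of the labels changes the fibre integral by `· ∘ γ`.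
[folklore] -/
theorem fibreIntegral_comp_perm (γ : Perm (Fin (m + 1))) (Φ : (Fin (k + 1) → ℝ) → ℂ)
    (ζ : Fin (m + 1) → ℝ) : fibreIntegral Q (γ ∘ ι) Φ ζ = fibreIntegral Q ι Φ (ζ ∘ γ) := by
  unfold fibreIntegral fillQ
  rfl

/-- **Rudnick–Sarnak (4.14): `ι_Q^* f_Φ = f_{Φ_Q}`.** For a set partition `Q` of `Fin (k+1)`
with a surjective block labelling `ι : Fin (k+1) → Fin (m+1)` and a continuous compactly
supported `Φ`, the pull-back of `f_Φ` along the block map is the test function of the fibre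
integral: `rsPhiTest (fibreIntegral Q ι Φ) z = rsPhiTest Φ (z ∘ ι)` for every `z`.
[cite: RudnickSarnak1996, (4.14)] -/
theorem rsPhiTest_fibreIntegral (hι : ∀ a b : Fin (k + 1), ι a = ι b ↔ Q.part a = Q.part b)
    (hιs : Function.Surjective ι) {Φ : (Fin (k + 1) → ℝ) → ℂ} (hΦc : Continuous Φ)
    (hΦs : HasCompactSupport Φ) (z : Fin (m + 1) → ℝ) :
    rsPhiTest (fibreIntegral Q ι Φ) z = rsPhiTest Φ (z ∘ ι) := by
  -- Step 1: the case `ι 0 = 0`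
  have key : ∀ (ι' : Fin (k + 1) → Fin (m + 1)) (hι' : ∀ a b, ι' a = ι' b ↔ Q.part a = Q.part b)
      (hιs' : Function.Surjective ι') (hι0' : ι' 0 = 0) (z' : Fin (m + 1) → ℝ),
      rsPhiTest (fibreIntegral Q ι' Φ) z' = rsPhiTest Φ (z' ∘ ι') := by
    intro ι' hι' hιs' hι0' z'
    rw [rsPhiTest_eq_hypInt, rsPhiTest_eq_hypInt]
    unfold hypInt
    -- the phase as a function on `ℝ^{k+1}`
    set F : (Fin (k + 1) → ℝ) → ℂ := fun ξ ↦ Φ ξ * Complex.exp (-(2 * π * I * ∑ j, ((z' ∘ ι') j * ξ j : ℝ)))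
      with hF
    have hFc : Continuous F := by
      simp only [hF]
      fun_prop
    have hFs : HasCompactSupport F := hΦs.mul_right
    rw [integral_hypPoint_eq_integral_integral_fillQ Q ι' hι' hιs' hι0' hFc hFs]
    refine integral_congr_ae (Filter.Eventually.of_forall fun θ ↦ ?_)
    simp only [hF, fibreIntegral]
    rw [← integral_mul_const]
    refine integral_congr_ae (Filter.Eventually.of_forall fun w ↦ ?_)
    simp only [Function.comp_apply]
    rw [sum_label_mul_fillQ Q ι' hι' hιs' z' (hypPoint θ) w]
  -- Step 2: relabel so that the block of `0` carries the label `0`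
  set γ : Perm (Fin (m + 1)) := Equiv.swap 0 (ι 0) with hγ
  have hγγ : ∀ b, γ (γ b) = b := fun b ↦ by simp [hγ, Equiv.swap_apply_self]
  set ι₂ : Fin (k + 1) → Fin (m + 1) := γ ∘ ι with hι₂
  have hι₂' : ∀ a b, ι₂ a = ι₂ b ↔ Q.part a = Q.part b := fun a b ↦ by
    rw [← hι]
    exact γ.injective.eq_iff
  have hι₂s : Function.Surjective ι₂ := γ.surjective.comp hιs
  have hι₂0 : ι₂ 0 = 0 := by simp [hι₂, hγ]
  have h1 := key ι₂ hι₂' hι₂s hι₂0 (z ∘ γ)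
  have hzι : (z ∘ ⇑γ) ∘ ι₂ = z ∘ ι := by
    funext a
    simp [hι₂, hγγ]
  rw [hzι] at h1
  rw [← h1, hι₂, show fibreIntegral Q (⇑γ ∘ ι) Φ = fun ζ ↦ fibreIntegral Q ι Φ (ζ ∘ ⇑γ) from
    funext (fibreIntegral_comp_perm Q ι γ Φ), rsPhiTest_comp_perm]
  congr 1
  funext a
  simp [hγγ]

end RudnickSarnak

end Literature.NumberTheory.LFunctions

end
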